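import Summits.NavierStokesRegularity.NavierStokesRegularity.Theorems.QuarterLogPincerTruncationEdgeDefs
import Summits.NavierStokesRegularity.NavierStokesRegularity.Theses.SymmetryModuliCount
import Summits.NavierStokesRegularity.NavierStokesRegularity.Theses.QuarterLogPincer
import Literature.Analysis.FluidPDE.NSQuasipotential
import HarnessLib

/-!
# The `quiet_collar` objects, typed — refuter side, negative lane (I): the rest state, item 4050, Q2

Crux `stmt-NavierStokesRegularity-24077` (`QuarterLogPincer.TypeIQuantSubcubicExp`), line
`Cruxes/TypeIQuantSubcubicExp/Lines/quiet_collar.lean` v1.1 (ns-idea-7 g9, 2026-08-28; tree sha16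
`8170489f8bcaaff9`; stubs QP1 `stub_quietCollar`, QP2 `stub_cutPair`, QP3 `stub_forcedTwoNormShadowing`,
Q2 `stub_logCubeExtraction`, Q3 `stub_localRateFloor`; Q1 `stub_quietTruncation` DERIVED from QP1–QP3 and
the landed frame bootstrap; values `LogCubeFloorLiouville`, `LogCubeLiouville`); and crux
`stmt-NavierStokesRegularity-24453` (`CalmSliceGate.AsymmetricFlickerLiouville`).

The line's objects live in a Cruxes workfile (not importable from `Theorems/`), so every statement
below is written over their BODIES, verbatim (`LocalRateFloor v` =
`∃ c s₀, 0 < c ∧ s₀ < 0 ∧ ∀ s ∈ Ico s₀ 0, ∃ x ∈ ball 0 1, c/√(−s) ≤ ‖v s x‖`;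
`LogCubeLiouville` = `∀ M v, IsTypeIAncientMild M v → EnvelopeCubeBudget v → ¬ SingularAt v 0`;
`LogCubeFloorLiouville` = `… → ¬ LocalRateFloor v`; Q1 = `… → EnvelopeCubeBudget v → ∃ M',
FarFieldTruncation M' v`; Q2 = `¬ 24077 → ∃ M v, IsTypeIAncientMild M v ∧ EnvelopeCubeBudget v ∧
LocalRateFloor v`; Q3 = `… → SingularAt v 0 → LocalRateFloor v`; QP1 = `… → QuietCollar v`; QP2 =
`… → CutPair v` with `mildDefect V t x` unfolded to `V t x − heatFlow (V 0) t x + oseenDuhamel 1 0 V V t x`),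
over the landed Theorems-level definitions `TaoFrame`, `SingularAt`, `EnvelopeCubeBudget`,
`FarFieldTruncation`, `HasTypeIDecay`, `IsTypeIAncientMild`, `heatFlow`, `oseenDuhamel`; the by-name
identity of each body with the line's `def` is an `Iff.rfl` check against a verbatim copy of the line (seat
folder `qc/QC4.lean`, rc 0). Nothing here asserts 24077, 24453, 22144, 4050 or a stub: every statement is
an implication between OPEN statements, a statement about the rest state, or pure logic. No summit
statement and no crux is proved by this file.

## Findings (kernel-checked below; refuter census, numbers not adjectives)

1. CONSISTENCY CEILING. Every `v`-quantified object of the line — QP1, QP2, Q1, Q3, `LogCubeLiouville`,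
   `LogCubeFloorLiouville` — follows from item stmt-4050 (`SymmetryModuliCount.TypeIAncientLiouville`,
   (L′) in the KNSS gauge): a field vanishing on the open past is neither singular nor floored, every
   collar of it is quiet, the REST STATE is a cut pair for it (`V ≡ 0`, `u₀ ≡ 0`, zero mild defect,
   `mildDefect_restState`), and T1's conclusion `FarFieldTruncation M' v` holds for it at every
   `M' ≥ −1` with the rest state as the truncation (`u ≡ 0`, `p ≡ 0`, `R = 2`, `κ = 0`, `K = 2`,
   `k = 0`; `taoFrame_zero`). QP3 (`ForcedTwoNormShadowing`) quantifies over no `v`: it is finite-time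
   Navier–Stokes perturbation theory and is untouched here. So no `v`-stub or value of the line is
   refutable short of a nonzero Type-I ancient mild solution (the wall object), and Q1's `u` is tied to
   `v` only through `‖u(1−ε,x) − v(−ε,x)‖ ≤ δ` on `B₁` and the `L³` clause. The hypotheses
   `IsTypeIAncientMild M v ∧ EnvelopeCubeBudget v` of both values are satisfiable (rest state, every
   `M ≥ 0`: `isTypeIAncientMild_zero`, `envelopeCubeBudget_zero`), where both conclusions hold.
2. Q2 IS THE CONVERSE EDGE: `StubLogCubeExtraction ↔ (LogCubeFloorLiouville → 24077)`
   (`logCubeExtraction_iff_converse`, pure logic).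
3./4. See the companion file `Negative/QuietCollarWall.lean`: `LogCubeLiouville → LogCubeFloorLiouville`
   without Q3, and the placement of both values on the `FiniteDissipationLiouville` / 24453 wall
   (every enveloped singular object, every Type-I DSS profile and every failure of
   `TypeIDSSLiouvilleConjecture` refutes both values).
-/

-- the summit and its single sub-problem share the name (CONVENTIONS §1), as in every Theorems file
set_option linter.dupNamespace false

namespace Summit.NavierStokesRegularity.NavierStokesRegularity.Theorems.TypeIQuantSubcubicExp.Negative

open MeasureTheory Set Filter Topology Metric Function
open Literature.Analysis Literature.Analysis.FluidPDE
open Summit.NavierStokesRegularity.NavierStokesRegularity.Theorems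
open Summit.NavierStokesRegularity.NavierStokesRegularity.Cruxes.TypeIQuantSubcubicExp.ThinCascade
  (TaoFrame SingularAt)
open Summit.NavierStokesRegularity.NavierStokesRegularity.Cruxes.TypeIQuantSubcubicExp.TruncationEdge
  (EnvelopeCubeBudget FarFieldTruncation)

open scoped ENNReal NNReal

/-! ### 1. Consistency ceiling: the rest state and item 4050 -/

/-- **The rest state is a Tao frame on every `[0,T]`** (`u ≡ 0`, `p ≡ 0` solve Navier–Stokes
classically, `isClassicalNSSolutionOn_zero`, and every `H^k` seminorm of `0` is `0`). [folklore] -/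
theorem taoFrame_zero (T : ℝ) :
    TaoFrame T (0 : ℝ → EuclideanSpace ℝ (Fin 3) → EuclideanSpace ℝ (Fin 3)) 0 := by
  refine ⟨isClassicalNSSolutionOn_zero (Set.Icc 0 T) 1, fun n => ⟨0, fun t _ => ?_⟩⟩
  have : (0 : ℝ → EuclideanSpace ℝ (Fin 3) → EuclideanSpace ℝ (Fin 3)) t =
      fun _ => (0 : EuclideanSpace ℝ (Fin 3)) := rfl
  rw [this, iteratedFDeriv_fun_zero]
  simp

/-- **T1's conclusion holds for every field vanishing on the open past, at every virtual rate
`M' ≥ −1`**, with the rest state as the truncation: witness `κ = 0`, `K = 2`, `R = 2`, `u ≡ 0`,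
`p ≡ 0`, `k = 0`. In particular the truncation `u` of `FarFieldTruncation M' v` is constrained by `v`
only through `‖u(1−ε,x) − v(−ε,x)‖ ≤ δ` on `B₁`. [folklore] -/
theorem farFieldTruncation_of_eq_zero {M' : ℝ} (hM' : -1 ≤ M')
    {v : ℝ → EuclideanSpace ℝ (Fin 3) → EuclideanSpace ℝ (Fin 3)}
    (hv : ∀ t < 0, ∀ x, v t x = 0) : FarFieldTruncation M' v := by
  intro δ hδ _
  refine ⟨0, 2, le_rfl, by norm_num, fun ε hε => ?_⟩
  have hεpos : 0 < ε := hε.1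
  have hε1 : ε ≤ 1 / 2 := hε.2
  refine ⟨2, 0, 0, le_rfl, ?_, taoFrame_zero _, ?_, ⟨0, le_rfl, ?_, ?_⟩, ?_⟩
  · rw [neg_zero, Real.rpow_zero]; norm_num
  · intro t ht x
    simp only [Pi.zero_apply, norm_zero]
    have h1 : 0 ≤ (1 - ε + ε - t) ^ (-(1 / 2 : ℝ)) :=
      Real.rpow_nonneg (by linarith [ht.2]) _
    have h2 : 0 ≤ M' + 1 := by linarith
    positivity
  · have hlog2 : 0 ≤ Real.log 2 := Real.log_nonneg (by norm_num)
    have hlog1 : 0 ≤ Real.log (1 / ε) := Real.log_nonneg (by rw [le_div_iff₀ hεpos]; linarith)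
    nlinarith
  · intro b hb _ t _
    simp [eLpNorm_zero]
  · intro x _
    rw [hv (-ε) (by linarith) x]
    simp only [Pi.zero_apply, sub_zero, norm_zero]
    exact hδ.le

/-- **A field vanishing on the open past is singular nowhere.** [folklore] -/
theorem not_singularAt_of_eq_zero {v : ℝ → EuclideanSpace ℝ (Fin 3) → EuclideanSpace ℝ (Fin 3)}
    (hv : ∀ t < 0, ∀ x, v t x = 0) (a : EuclideanSpace ℝ (Fin 3)) : ¬ SingularAt v a := by
  intro h
  obtain ⟨t, ht, y, -, hy⟩ := h 1 one_pos 0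
  rw [hv t ht.2 y, norm_zero] at hy
  exact lt_irrefl _ hy

/-- **A field vanishing on the open past has no localised Leray floor** (`¬ LocalRateFloor v`, body
verbatim). [folklore] -/
theorem not_localRateFloor_of_eq_zero {v : ℝ → EuclideanSpace ℝ (Fin 3) → EuclideanSpace ℝ (Fin 3)}
    (hv : ∀ t < 0, ∀ x, v t x = 0) :
    ¬ ∃ c s₀ : ℝ, 0 < c ∧ s₀ < 0 ∧ ∀ s ∈ Set.Ico s₀ 0,
      ∃ x ∈ Metric.ball (0 : EuclideanSpace ℝ (Fin 3)) 1, c / Real.sqrt (-s) ≤ ‖v s x‖ := by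
  rintro ⟨c, s₀, hc, hs₀, h⟩
  obtain ⟨x, -, hx⟩ := h s₀ ⟨le_rfl, hs₀⟩
  rw [hv s₀ hs₀ x, norm_zero] at hx
  exact absurd hx (not_le.2 (div_pos hc (Real.sqrt_pos.2 (by linarith))))

/-- **Item stmt-4050 ⇒ Q1** (`StubQuietTruncation`, body verbatim; CONDITIONAL, 4050 is open): with
`M' = 0` and the rest state as truncation. [folklore] -/
theorem quietTruncation_of_typeIAncientLiouville
    (h : Summit.NavierStokesRegularity.NavierStokesRegularity.Theses.SymmetryModuliCount.TypeIAncientLiouville) :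
    ∀ (M : ℝ) (v : ℝ → EuclideanSpace ℝ (Fin 3) → EuclideanSpace ℝ (Fin 3)),
      IsTypeIAncientMild M v → EnvelopeCubeBudget v → ∃ M' : ℝ, FarFieldTruncation M' v :=
  fun M v hv _ => ⟨0, farFieldTruncation_of_eq_zero (by norm_num) (h M v (isTypeIAncientMild_iff.1 hv))⟩

/-- **Item stmt-4050 ⇒ Q3** (`StubLocalRateFloor`, body verbatim; CONDITIONAL): under (L′) no member
of the class is singular, so Q3 holds vacuously. [folklore] -/
theorem localRateFloorStub_of_typeIAncientLiouville
    (h : Summit.NavierStokesRegularity.NavierStokesRegularity.Theses.SymmetryModuliCount.TypeIAncientLiouville) :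
    ∀ (M : ℝ) (v : ℝ → EuclideanSpace ℝ (Fin 3) → EuclideanSpace ℝ (Fin 3)),
      IsTypeIAncientMild M v → SingularAt v 0 →
      ∃ c s₀ : ℝ, 0 < c ∧ s₀ < 0 ∧ ∀ s ∈ Set.Ico s₀ 0,
        ∃ x ∈ Metric.ball (0 : EuclideanSpace ℝ (Fin 3)) 1, c / Real.sqrt (-s) ≤ ‖v s x‖ :=
  fun M v hv hsing => (not_singularAt_of_eq_zero (h M v (isTypeIAncientMild_iff.1 hv)) 0 hsing).elim

/-- **Item stmt-4050 ⇒ `LogCubeLiouville`** (body verbatim; CONDITIONAL). [folklore] -/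
theorem logCubeLiouville_of_typeIAncientLiouville
    (h : Summit.NavierStokesRegularity.NavierStokesRegularity.Theses.SymmetryModuliCount.TypeIAncientLiouville) :
    ∀ (M : ℝ) (v : ℝ → EuclideanSpace ℝ (Fin 3) → EuclideanSpace ℝ (Fin 3)),
      IsTypeIAncientMild M v → EnvelopeCubeBudget v → ¬ SingularAt v 0 :=
  fun M v hv _ => not_singularAt_of_eq_zero (h M v (isTypeIAncientMild_iff.1 hv)) 0

/-- **Item stmt-4050 ⇒ `LogCubeFloorLiouville`** (body verbatim; CONDITIONAL). [folklore] -/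
theorem logCubeFloorLiouville_of_typeIAncientLiouville
    (h : Summit.NavierStokesRegularity.NavierStokesRegularity.Theses.SymmetryModuliCount.TypeIAncientLiouville) :
    ∀ (M : ℝ) (v : ℝ → EuclideanSpace ℝ (Fin 3) → EuclideanSpace ℝ (Fin 3)),
      IsTypeIAncientMild M v → EnvelopeCubeBudget v →
      ¬ ∃ c s₀ : ℝ, 0 < c ∧ s₀ < 0 ∧ ∀ s ∈ Set.Ico s₀ 0,
        ∃ x ∈ Metric.ball (0 : EuclideanSpace ℝ (Fin 3)) 1, c / Real.sqrt (-s) ≤ ‖v s x‖ :=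
  fun M v hv _ => not_localRateFloor_of_eq_zero (h M v (isTypeIAncientMild_iff.1 hv))

/-- **The rest state meets the envelope cube budget** (`B = 0`, `b = 0`): together with
`isTypeIAncientMild_zero` the common hypotheses of both values are satisfiable. [folklore] -/
theorem envelopeCubeBudget_zero :
    EnvelopeCubeBudget (0 : ℝ → EuclideanSpace ℝ (Fin 3) → EuclideanSpace ℝ (Fin 3)) :=
  ⟨0, le_rfl, fun R _ ε _ => ⟨0, le_rfl, by simp, fun s _ => by simp⟩⟩

/-- The hypotheses of `LogCubeLiouville` / `LogCubeFloorLiouville` are jointly satisfiable (rest state,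
every rate `M ≥ 0`), and both conclusions hold there. [folklore] -/
theorem logCube_hypotheses_restState {M : ℝ} (hM : 0 ≤ M) :
    IsTypeIAncientMild M (0 : ℝ → EuclideanSpace ℝ (Fin 3) → EuclideanSpace ℝ (Fin 3)) ∧
      EnvelopeCubeBudget (0 : ℝ → EuclideanSpace ℝ (Fin 3) → EuclideanSpace ℝ (Fin 3)) ∧
      ¬ SingularAt (0 : ℝ → EuclideanSpace ℝ (Fin 3) → EuclideanSpace ℝ (Fin 3)) 0 ∧
      ¬ ∃ c s₀ : ℝ, 0 < c ∧ s₀ < 0 ∧ ∀ s ∈ Set.Ico s₀ 0,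
        ∃ x ∈ Metric.ball (0 : EuclideanSpace ℝ (Fin 3)) 1,
          c / Real.sqrt (-s) ≤ ‖(0 : ℝ → EuclideanSpace ℝ (Fin 3) → EuclideanSpace ℝ (Fin 3)) s x‖ :=
  ⟨isTypeIAncientMild_zero hM, envelopeCubeBudget_zero,
    not_singularAt_of_eq_zero (fun _ _ _ => rfl) 0, not_localRateFloor_of_eq_zero fun _ _ _ => rfl⟩


/-! ### 1b. v1.1 anatomy of Q1: QP1 and QP2 under item 4050 (QP3 is `v`-free) -/

/-- The heat flow of the zero slice and the Oseen–Duhamel term of the rest state vanish: the MILD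
DEFECT (`mildDefect`, body verbatim) of the rest state is `0` at every time. [folklore] -/
theorem mildDefect_restState (t : ℝ) (x : EuclideanSpace ℝ (Fin 3)) :
    (0 : ℝ → EuclideanSpace ℝ (Fin 3) → EuclideanSpace ℝ (Fin 3)) t x -
        heatFlow ((0 : ℝ → EuclideanSpace ℝ (Fin 3) → EuclideanSpace ℝ (Fin 3)) 0) t x +
      oseenDuhamel 1 0 (0 : ℝ → EuclideanSpace ℝ (Fin 3) → EuclideanSpace ℝ (Fin 3)) 0 t x = 0 := by
  have h0 : heatFlow ((0 : ℝ → EuclideanSpace ℝ (Fin 3) → EuclideanSpace ℝ (Fin 3)) 0) t x = 0 := by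
    by_cases ht : 0 < t
    · rw [heatFlow_of_pos _ ht]
      exact UnboundedOperators.heatExtension_const (0 : EuclideanSpace ℝ (Fin 3)) ht x
    · rw [heatFlow_of_nonpos _ (not_lt.1 ht)]; rfl
  rw [oseenDuhamel_zero_left, h0]
  simp

/-- **QP1 (`QuietCollar v`, body verbatim) holds for every field vanishing on the open past**: every
collar is quiet (`r = 2`, `κ₁ = k`, `K₁ = 2 + K`). [folklore] -/
theorem quietCollar_of_eq_zero {v : ℝ → EuclideanSpace ℝ (Fin 3) → EuclideanSpace ℝ (Fin 3)}
    (hv : ∀ t < 0, ∀ x, v t x = 0) :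
    ∀ k K : ℝ, 0 ≤ k → 1 ≤ K → ∃ κ₁ K₁ : ℝ, 0 ≤ κ₁ ∧ 2 ≤ K₁ ∧
      ∀ ε ∈ Set.Ioc (0 : ℝ) (1 / 2), ∀ ηq Lq : ℝ, ε ^ k / K ≤ ηq → 0 < Lq → Lq ≤ K * ε ^ (-k) →
        ∃ r : ℝ, 2 ≤ r ∧ r + Lq ≤ K₁ * ε ^ (-κ₁) ∧
          ∀ s ∈ Set.Icc (-1 : ℝ) (-ε), ∀ x : EuclideanSpace ℝ (Fin 3),
            r ≤ ‖x‖ → ‖x‖ ≤ r + Lq → ‖v s x‖ ≤ ηq := by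
  intro k K hk hK
  have hKpos : 0 < K := by linarith
  refine ⟨k, 2 + K, hk, by linarith, fun ε hε ηq Lq hηq _ hLqK => ⟨2, le_rfl, ?_, fun s hs x _ _ => ?_⟩⟩
  · have h1 : (1 : ℝ) ≤ ε ^ (-k) :=
      Real.one_le_rpow_of_pos_of_le_one_of_nonpos hε.1 (by linarith [hε.2]) (by linarith)
    nlinarith
  · have hεpos : 0 < ε := hε.1
    rw [hv s (by linarith [hs.2]) x, norm_zero]
    exact le_trans (by positivity) hηq

/-- **QP2 (`CutPair v`, body verbatim, `mildDefect` unfolded) holds for every field vanishing on the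
open past**, with the rest state as cut pair: `k₂ = 0`, `K₂ = 1`, `ηq = Lq = 1`, `R = r + 1`, `V ≡ 0`,
`u₀ ≡ 0`. [folklore] -/
theorem cutPair_of_eq_zero {v : ℝ → EuclideanSpace ℝ (Fin 3) → EuclideanSpace ℝ (Fin 3)}
    (hv : ∀ t < 0, ∀ x, v t x = 0) :
    ∀ η₁ n : ℝ, 0 < η₁ → 0 ≤ n → ∃ k₂ K₂ : ℝ, 0 ≤ k₂ ∧ 1 ≤ K₂ ∧
      ∀ ε ∈ Set.Ioc (0 : ℝ) (1 / 2), ∃ ηq Lq : ℝ, ε ^ k₂ / K₂ ≤ ηq ∧ 0 < Lq ∧ Lq ≤ K₂ * ε ^ (-k₂) ∧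
        ∀ r : ℝ, 2 ≤ r →
          (∀ s ∈ Set.Icc (-1 : ℝ) (-ε), ∀ x : EuclideanSpace ℝ (Fin 3),
              r ≤ ‖x‖ → ‖x‖ ≤ r + Lq → ‖v s x‖ ≤ ηq) →
          ∃ (R : ℝ) (V : ℝ → EuclideanSpace ℝ (Fin 3) → EuclideanSpace ℝ (Fin 3))
            (u₀ : EuclideanSpace ℝ (Fin 3) → EuclideanSpace ℝ (Fin 3)),
            r + Lq ≤ R ∧ R ≤ K₂ * ε ^ (-k₂) * (r * r) ∧
            ContDiff ℝ (⊤ : ℕ∞) u₀ ∧ VectorCalculus.IsDivFree u₀ ∧ HasCompactSupport u₀ ∧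
            (∀ x, ‖u₀ x - V 0 x‖ ≤ η₁ * ε ^ n) ∧
            ContinuousOn (uncurry V) (Set.Icc 0 (1 - ε) ×ˢ Set.univ) ∧
            (∀ t ∈ Set.Icc 0 (1 - ε), ∀ x, ‖V t x‖ ≤ ‖v (t - 1) x‖) ∧
            (∀ t ∈ Set.Icc 0 (1 - ε), ∀ x : EuclideanSpace ℝ (Fin 3), R ≤ ‖x‖ → V t x = 0) ∧
            (∀ t ∈ Set.Icc 0 (1 - ε), ∀ x : EuclideanSpace ℝ (Fin 3), ‖x‖ ≤ r → V t x = v (t - 1) x) ∧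
            (∀ t ∈ Set.Icc 0 (1 - ε), eLpNorm (V t) 3 volume ≤
                eLpNorm ((Metric.ball (0 : EuclideanSpace ℝ (Fin 3)) R).indicator (v (t - 1))) 3 volume) ∧
            (∀ t ∈ Set.Icc 0 (1 - ε), ∀ x, ‖V t x - heatFlow (V 0) t x + oseenDuhamel 1 0 V V t x‖ ≤ η₁ * ε ^ n) ∧
            (∀ b : ℝ, 0 ≤ b →
              (∀ s ∈ Set.Icc (-1 : ℝ) (-ε),
                  eLpNorm ((Metric.ball (0 : EuclideanSpace ℝ (Fin 3)) R).indicator (v s)) 3 volume ≤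
                    ENNReal.ofReal b) →
              eLpNorm (fun x => u₀ x - V 0 x) 3 volume ≤ ENNReal.ofReal (K₂ * (b + 1)) ∧
              ∀ t ∈ Set.Icc 0 (1 - ε), eLpNorm (fun x => V t x - heatFlow (V 0) t x + oseenDuhamel 1 0 V V t x) 3 volume ≤ ENNReal.ofReal (K₂ * (b + 1))) := by
  intro η₁ n hη₁ hn
  refine ⟨0, 1, le_rfl, le_rfl, fun ε hε => ⟨1, 1, ?_, one_pos, ?_, fun r hr _ => ?_⟩⟩
  · rw [Real.rpow_zero, div_one]
  · rw [neg_zero, Real.rpow_zero, mul_one]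
  have hεpos : 0 < ε := hε.1
  refine ⟨r + 1, 0, 0, le_rfl, ?_, ?_, ?_, ?_, ?_, continuousOn_const, ?_, ?_, ?_, ?_, ?_, ?_⟩
  · rw [neg_zero, Real.rpow_zero, mul_one, one_mul]; nlinarith
  · exact contDiff_const
  · exact (isTypeIAncientMild_zero le_rfl).isDivFree (show (-1 : ℝ) < 0 by norm_num)
  · exact HasCompactSupport.intro isCompact_empty fun _ _ => rfl
  · intro x
    simp only [Pi.zero_apply, sub_zero, norm_zero]
    positivity
  · intro t _ x
    simp only [Pi.zero_apply, norm_zero]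
    exact norm_nonneg _
  · intro _ _ _ _; rfl
  · intro t ht x _
    exact (hv (t - 1) (by linarith [ht.2]) x).symm
  · intro t _
    simp
  · intro t _ x
    rw [mildDefect_restState]
    simp only [norm_zero]
    positivity
  · intro b hb _
    refine ⟨by simp, fun t _ => ?_⟩
    have e : (fun x => (0 : ℝ → EuclideanSpace ℝ (Fin 3) → EuclideanSpace ℝ (Fin 3)) t x -
        heatFlow ((0 : ℝ → EuclideanSpace ℝ (Fin 3) → EuclideanSpace ℝ (Fin 3)) 0) t x +
        oseenDuhamel 1 0 (0 : ℝ → EuclideanSpace ℝ (Fin 3) → EuclideanSpace ℝ (Fin 3)) 0 t x) =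
        fun _ => 0 := funext fun x => mildDefect_restState t x
    rw [e]
    simp

/-- **Item stmt-4050 ⇒ QP1** (`StubQuietCollar`, body verbatim; CONDITIONAL, 4050 is open). [folklore] -/
theorem quietCollarStub_of_typeIAncientLiouville
    (h : Summit.NavierStokesRegularity.NavierStokesRegularity.Theses.SymmetryModuliCount.TypeIAncientLiouville) :
    ∀ (M : ℝ) (v : ℝ → EuclideanSpace ℝ (Fin 3) → EuclideanSpace ℝ (Fin 3)),
      IsTypeIAncientMild M v → EnvelopeCubeBudget v →
      ∀ k K : ℝ, 0 ≤ k → 1 ≤ K → ∃ κ₁ K₁ : ℝ, 0 ≤ κ₁ ∧ 2 ≤ K₁ ∧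
        ∀ ε ∈ Set.Ioc (0 : ℝ) (1 / 2), ∀ ηq Lq : ℝ, ε ^ k / K ≤ ηq → 0 < Lq → Lq ≤ K * ε ^ (-k) →
          ∃ r : ℝ, 2 ≤ r ∧ r + Lq ≤ K₁ * ε ^ (-κ₁) ∧
            ∀ s ∈ Set.Icc (-1 : ℝ) (-ε), ∀ x : EuclideanSpace ℝ (Fin 3),
              r ≤ ‖x‖ → ‖x‖ ≤ r + Lq → ‖v s x‖ ≤ ηq :=
  fun M v hv _ => quietCollar_of_eq_zero (h M v (isTypeIAncientMild_iff.1 hv))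

/-- **Item stmt-4050 ⇒ QP2** (`StubCutPair`, body verbatim, `mildDefect` unfolded; CONDITIONAL).
[folklore] -/
theorem cutPairStub_of_typeIAncientLiouville
    (h : Summit.NavierStokesRegularity.NavierStokesRegularity.Theses.SymmetryModuliCount.TypeIAncientLiouville) :
    ∀ (M : ℝ) (v : ℝ → EuclideanSpace ℝ (Fin 3) → EuclideanSpace ℝ (Fin 3)),
      IsTypeIAncientMild M v → EnvelopeCubeBudget v →
      ∀ η₁ n : ℝ, 0 < η₁ → 0 ≤ n → ∃ k₂ K₂ : ℝ, 0 ≤ k₂ ∧ 1 ≤ K₂ ∧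
        ∀ ε ∈ Set.Ioc (0 : ℝ) (1 / 2), ∃ ηq Lq : ℝ, ε ^ k₂ / K₂ ≤ ηq ∧ 0 < Lq ∧ Lq ≤ K₂ * ε ^ (-k₂) ∧
          ∀ r : ℝ, 2 ≤ r →
            (∀ s ∈ Set.Icc (-1 : ℝ) (-ε), ∀ x : EuclideanSpace ℝ (Fin 3),
                r ≤ ‖x‖ → ‖x‖ ≤ r + Lq → ‖v s x‖ ≤ ηq) →
            ∃ (R : ℝ) (V : ℝ → EuclideanSpace ℝ (Fin 3) → EuclideanSpace ℝ (Fin 3))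
              (u₀ : EuclideanSpace ℝ (Fin 3) → EuclideanSpace ℝ (Fin 3)),
              r + Lq ≤ R ∧ R ≤ K₂ * ε ^ (-k₂) * (r * r) ∧
              ContDiff ℝ (⊤ : ℕ∞) u₀ ∧ VectorCalculus.IsDivFree u₀ ∧ HasCompactSupport u₀ ∧
              (∀ x, ‖u₀ x - V 0 x‖ ≤ η₁ * ε ^ n) ∧
              ContinuousOn (uncurry V) (Set.Icc 0 (1 - ε) ×ˢ Set.univ) ∧
              (∀ t ∈ Set.Icc 0 (1 - ε), ∀ x, ‖V t x‖ ≤ ‖v (t - 1) x‖) ∧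
              (∀ t ∈ Set.Icc 0 (1 - ε), ∀ x : EuclideanSpace ℝ (Fin 3), R ≤ ‖x‖ → V t x = 0) ∧
              (∀ t ∈ Set.Icc 0 (1 - ε), ∀ x : EuclideanSpace ℝ (Fin 3), ‖x‖ ≤ r → V t x = v (t - 1) x) ∧
              (∀ t ∈ Set.Icc 0 (1 - ε), eLpNorm (V t) 3 volume ≤
                  eLpNorm ((Metric.ball (0 : EuclideanSpace ℝ (Fin 3)) R).indicator (v (t - 1))) 3 volume) ∧
              (∀ t ∈ Set.Icc 0 (1 - ε), ∀ x, ‖V t x - heatFlow (V 0) t x + oseenDuhamel 1 0 V V t x‖ ≤ η₁ * ε ^ n) ∧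
              (∀ b : ℝ, 0 ≤ b →
                (∀ s ∈ Set.Icc (-1 : ℝ) (-ε),
                    eLpNorm ((Metric.ball (0 : EuclideanSpace ℝ (Fin 3)) R).indicator (v s)) 3 volume ≤
                      ENNReal.ofReal b) →
                eLpNorm (fun x => u₀ x - V 0 x) 3 volume ≤ ENNReal.ofReal (K₂ * (b + 1)) ∧
                ∀ t ∈ Set.Icc 0 (1 - ε), eLpNorm (fun x => V t x - heatFlow (V 0) t x + oseenDuhamel 1 0 V V t x) 3 volume ≤ ENNReal.ofReal (K₂ * (b + 1))) :=
  fun M v hv _ => cutPair_of_eq_zero (h M v (isTypeIAncientMild_iff.1 hv))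

/-! ### 2. Q2 is the converse edge -/

/-- **Q2 (`StubLogCubeExtraction`) ⟺ (`LogCubeFloorLiouville` → 24077)** (bodies verbatim; pure
logic). [folklore] -/
theorem logCubeExtraction_iff_converse :
    (¬ Summit.NavierStokesRegularity.NavierStokesRegularity.Theses.QuarterLogPincer.TypeIQuantSubcubicExp →
      ∃ (M : ℝ) (v : ℝ → EuclideanSpace ℝ (Fin 3) → EuclideanSpace ℝ (Fin 3)),
        IsTypeIAncientMild M v ∧ EnvelopeCubeBudget v ∧
        ∃ c s₀ : ℝ, 0 < c ∧ s₀ < 0 ∧ ∀ s ∈ Set.Ico s₀ 0,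
          ∃ x ∈ Metric.ball (0 : EuclideanSpace ℝ (Fin 3)) 1, c / Real.sqrt (-s) ≤ ‖v s x‖) ↔
    ((∀ (M : ℝ) (v : ℝ → EuclideanSpace ℝ (Fin 3) → EuclideanSpace ℝ (Fin 3)),
        IsTypeIAncientMild M v → EnvelopeCubeBudget v →
        ¬ ∃ c s₀ : ℝ, 0 < c ∧ s₀ < 0 ∧ ∀ s ∈ Set.Ico s₀ 0,
          ∃ x ∈ Metric.ball (0 : EuclideanSpace ℝ (Fin 3)) 1, c / Real.sqrt (-s) ≤ ‖v s x‖) →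
      Summit.NavierStokesRegularity.NavierStokesRegularity.Theses.QuarterLogPincer.TypeIQuantSubcubicExp) := by
  constructor
  · intro hQ2 hL
    by_contra h
    obtain ⟨M, v, hv, hb, hf⟩ := hQ2 h
    exact hL M v hv hb hf
  · intro himp hneg
    by_contra hno
    exact hneg (himp fun M v hv hb hf => hno ⟨M, v, hv, hb, hf⟩)

end Summit.NavierStokesRegularity.NavierStokesRegularity.Theorems.TypeIQuantSubcubicExp.Negative
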